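import Literature.Probability.LatticeModels.AxisSpectralRepresentationProofs
import Literature.Probability.LatticeModels.CriticalTwoPointBounds
import Literature.Analysis.SpecialFunctions.BesselKHalfIntegral
import HarnessLib

/-!
# The axial two-point function of the Ising model is a one-variable Gaussian scale mixture

Topic `Literature/Probability/LatticeModels`; family `crit-ising`. Everything here is proved.

Along a principal axis the two-point function of the nearest-neighbour Ising model in the regime
`m*(β) = 0` is a Laplace transform in `|n|`, `⟨σ₀σ_{n eᵢ}⟩⁺_β = ∫ e^{-a|n|} dμ(a)`
(Aizenman–Duminil-Copin, Ann. of Math. 194 (2021), App. §8.3 Prop. 8.6; tree: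
`AizenmanDuminilCopin2021_prop_8_6_holds`). Composing with the **Lévy (one-half–stable)
subordination identity**

  `e^{-a√c} = ∫₀^∞ (2√π)⁻¹ a s^{-3/2} e^{-a²/(4s)} e^{-c s} ds`  (`a ≥ 0`, `c ≥ 0`),

i.e. `u ↦ e^{-a√u}` is completely monotone / the Laplace transform of the Lévy law of scale `a²`
(P. Lévy 1939; W. Feller, *An Introduction to Probability Theory* II (1971), XIII.3 and II.4(f);
K. Sato, *Lévy processes*, Ex. 2.13), it becomes a GAUSSIAN SCALE MIXTURE in `n`:

  `⟨σ₀σ_{n eᵢ}⟩⁺_β = ∫ e^{-s n²} dρ(s)`,  `ρ` a finite positive measure on `[0, ∞)`,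

and at `β = β_c(d)`, `d ≥ 3` (where `m*(β_c) = 0`, `β_c > 0` and `⟨σ₀σ₀⟩ = 1`), `ρ` is a
probability measure. This is the one-direction shadow of the conjectural JOINT Gaussian-scale-mixture
structure of the critical two-point function on `ℤ³` (route `GaussianScaleMixture`, crux
`CriticalTwoPointGSM` of summit problem `Ising3DConformalLimit`): every axial restriction of
`⟨σ₀σ_x⟩⁺_{β_c}` IS a Gaussian scale mixture (Bochner–Schoenberg: `e^{-a√u}` is completely monotone).

## Contents

* `AxisGSM.levyMeasure` — the standard Lévy law on `(0,∞)`, density `(2√π)⁻¹ s^{-3/2} e^{-1/(4s)}`;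
  `AxisGSM.integral_exp_neg_mul_levyMeasure` — its Laplace transform `∫ e^{-c s} dℓ = e^{-√c}`
  (`c > 0`; from the tree's `K_{1/2}` integral `BesselKHalf.integral_inv_sqrt_mul_inv_mul_exp_neg_div_add_mul`);
  `AxisGSM.isProbabilityMeasure_levyMeasure` — total mass `1` (monotone convergence `c ↓ 0`).
* `AxisGSM.exists_gsm_of_laplace` — SUBORDINATION: a kernel `n ↦ ∫ e^{-a|n|} dμ(a)` with `μ` finite
  on `[0,∞)` equals `∫ e^{-s n²} dρ(s)` with `ρ := (μ ⊗ ℓ).map ((a,s) ↦ a²s)` finite on `[0,∞)`,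
  `ρ(ℝ) = μ(ℝ)`.
* `twoPointPlus_axis_gaussianScaleMixture` (`m*(β) = 0`, `β > 0`) and
  `criticalTwoPoint_axis_gaussianScaleMixture` (`d ≥ 3`, probability mixing measure).

## References

* M. Aizenman, H. Duminil-Copin, Ann. of Math. 194 (2021), arXiv:1912.07973, App. §8.3 Prop. 8.6.
  [AizenmanDuminilCopinAnnals2021]
* W. Feller, *An Introduction to Probability Theory and its Applications* II, 2nd ed. (1971),
  XIII.3 Example (b) / II.4 (f) (Laplace transform `e^{-√(2λ)}` of the stable-½ law). [folklore]
* G. N. Watson, *Treatise on the Theory of Bessel Functions* (1944), §6.22 (15), §3.71 (13). [Watson1944]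
-/

noncomputable section

namespace Literature.Probability.LatticeModels

open _root_.MeasureTheory Set Filter Real
open scoped _root_.Topology ENNReal NNReal

namespace AxisGSM

/-! ## The Lévy law and its Laplace transform -/

/-- The standard Lévy (stable-½) density `ℓ(s) = (2√π)⁻¹ (√s)⁻¹ s⁻¹ e^{-1/(4s)}` (value `0` for
`s ≤ 0`, since `√s = 0` there). [folklore] -/
def levyDensity (s : ℝ) : ℝ :=
  (2 * Real.sqrt Real.pi)⁻¹ * ((Real.sqrt s)⁻¹ * s⁻¹ * Real.exp (-(1 / 4 * s⁻¹)))

/-- `ℓ ≥ 0`. [folklore] -/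
theorem levyDensity_nonneg (s : ℝ) : 0 ≤ levyDensity s := by
  unfold levyDensity
  rcases le_or_gt s 0 with hs | hs
  · have : Real.sqrt s = 0 := Real.sqrt_eq_zero'.2 hs
    simp [this]
  · positivity

/-- `ℓ` is measurable. [folklore] -/
theorem measurable_levyDensity : Measurable levyDensity := by
  unfold levyDensity
  fun_prop

/-- The standard Lévy law `ℓ(s) ds` on `(0, ∞)` as a measure on `ℝ`. [folklore] -/
def levyMeasure : Measure ℝ :=
  (volume.restrict (Ioi (0 : ℝ))).withDensity fun s => ((levyDensity s).toNNReal : ℝ≥0∞)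

/-- Integrals against the Lévy law are weighted Lebesgue integrals over `(0,∞)`. [folklore] -/
theorem integral_levyMeasure (g : ℝ → ℝ) :
    ∫ s, g s ∂levyMeasure = ∫ s in Ioi (0 : ℝ), levyDensity s * g s := by
  unfold levyMeasure
  rw [integral_withDensity_eq_integral_smul (measurable_levyDensity.real_toNNReal) g]
  refine integral_congr_ae (Eventually.of_forall fun s => ?_)
  simp only [NNReal.smul_def, smul_eq_mul, Real.coe_toNNReal _ (levyDensity_nonneg s)]

/-- The Lévy law gives no mass to `(-∞, 0]`. [folklore] -/
theorem levyMeasure_Iic_zero : levyMeasure (Iic (0 : ℝ)) = 0 := by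
  unfold levyMeasure
  rw [withDensity_apply _ measurableSet_Iic, Measure.restrict_restrict measurableSet_Iic]
  have : Iic (0 : ℝ) ∩ Ioi 0 = ∅ := by
    ext x; simp
  rw [this, Measure.restrict_empty, lintegral_zero_measure]

/-- **Laplace transform of the Lévy law**: `∫ e^{-c s} dℓ(s) = e^{-√c}` for `c > 0`, with
integrability of `ℓ(s) e^{-cs}` on `(0,∞)` — the `K_{1/2}` integral
`∫₀^∞ s^{-3/2} e^{-(β/s + αs)} ds = √(π/β) e^{-2√(αβ)}` at `β = 1/4`, `α = c`.
(Feller II, XIII.3; Watson §6.22 (15).) [folklore] -/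
theorem integrableOn_and_integral_levyDensity_mul_exp {c : ℝ} (hc : 0 < c) :
    IntegrableOn (fun s => levyDensity s * Real.exp (-(c * s))) (Ioi 0) ∧
      ∫ s in Ioi (0 : ℝ), levyDensity s * Real.exp (-(c * s)) = Real.exp (-Real.sqrt c) := by
  obtain ⟨hint, hval⟩ :=
    Literature.Analysis.SpecialFunctions.BesselKHalf.integral_inv_sqrt_mul_inv_mul_exp_neg_div_add_mul
      hc (by norm_num : (0 : ℝ) < 1 / 4)
  have hpt : ∀ s : ℝ, levyDensity s * Real.exp (-(c * s)) =
      (2 * Real.sqrt Real.pi)⁻¹ * ((Real.sqrt s)⁻¹ * s⁻¹ * Real.exp (-(1 / 4 * s⁻¹ + c * s))) := by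
    intro s
    unfold levyDensity
    rw [neg_add, Real.exp_add]
    ring
  simp_rw [hpt]
  refine ⟨hint.const_mul _, ?_⟩
  rw [integral_const_mul, hval]
  have hpi : 0 < Real.sqrt Real.pi := Real.sqrt_pos.2 Real.pi_pos
  have e1 : Real.sqrt (Real.pi / (1 / 4)) = 2 * Real.sqrt Real.pi := by
    rw [show Real.pi / (1 / 4) = 2 ^ 2 * Real.pi by ring, Real.sqrt_mul (by norm_num),
      Real.sqrt_sq (by norm_num)]
  have e2 : 2 * Real.sqrt (c * (1 / 4)) = Real.sqrt c := by
    rw [show c * (1 / 4) = c / 2 ^ 2 by ring, Real.sqrt_div' _ (by norm_num : (0:ℝ) ≤ 2 ^ 2),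
      Real.sqrt_sq (by norm_num)]
    ring
  rw [e1, e2, ← mul_assoc, inv_mul_cancel₀ (by positivity), one_mul]

/-- `∫ e^{-c s} dℓ(s) = e^{-√c}` for `c > 0`. [folklore] -/
theorem integral_exp_neg_mul_levyMeasure {c : ℝ} (hc : 0 < c) :
    ∫ s, Real.exp (-(c * s)) ∂levyMeasure = Real.exp (-Real.sqrt c) := by
  rw [integral_levyMeasure, (integrableOn_and_integral_levyDensity_mul_exp hc).2]

/-- The Lévy law is a probability measure: `∫₀^∞ ℓ = 1` (monotone convergence in
`∫ ℓ(s) e^{-s/k²} ds = e^{-1/k} ↑ 1`). [folklore] -/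
instance isProbabilityMeasure_levyMeasure : IsProbabilityMeasure levyMeasure := by
  constructor
  -- total mass as a `lintegral` of the density
  have hmass : levyMeasure univ = ∫⁻ s in Ioi (0 : ℝ), ENNReal.ofReal (levyDensity s) := by
    unfold levyMeasure
    rw [withDensity_apply _ MeasurableSet.univ, Measure.restrict_univ]
    rfl
  -- the truncated masses `∫ ℓ e^{-c_k s}`, `c_k = 1/(k+1)²`
  set c : ℕ → ℝ := fun k => ((k : ℝ) + 1)⁻¹ ^ 2 with hc
  have hcpos : ∀ k, 0 < c k := fun k => by positivity
  have hF : ∀ k, ∫⁻ s in Ioi (0 : ℝ), ENNReal.ofReal (levyDensity s * Real.exp (-(c k * s))) =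
      ENNReal.ofReal (Real.exp (-Real.sqrt (c k))) := by
    intro k
    obtain ⟨hint, hval⟩ := integrableOn_and_integral_levyDensity_mul_exp (hcpos k)
    rw [← hval, ofReal_integral_eq_lintegral_ofReal hint]
    exact Eventually.of_forall fun s => mul_nonneg (levyDensity_nonneg s) (Real.exp_pos _).le
  -- monotone convergence
  have hmono : Monotone fun k => fun s : ℝ => ENNReal.ofReal (levyDensity s * Real.exp (-(c k * s))) := by
    intro k l hkl s
    by_cases hs : s ≤ 0
    · have : levyDensity s = 0 := by
        unfold levyDensity; rw [Real.sqrt_eq_zero'.2 hs]; simp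
      simp [this]
    push Not at hs
    refine ENNReal.ofReal_le_ofReal (mul_le_mul_of_nonneg_left ?_ (levyDensity_nonneg s))
    refine Real.exp_le_exp.2 (neg_le_neg (mul_le_mul_of_nonneg_right ?_ hs.le))
    simp only [hc]
    gcongr
  have hsup : ∀ s : ℝ, ⨆ k, ENNReal.ofReal (levyDensity s * Real.exp (-(c k * s))) =
      ENNReal.ofReal (levyDensity s) := by
    intro s
    have ht : Tendsto (fun k => ENNReal.ofReal (levyDensity s * Real.exp (-(c k * s)))) atTop
        (𝓝 (ENNReal.ofReal (levyDensity s))) := by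
      refine ENNReal.tendsto_ofReal ?_
      have h1 : Tendsto (fun k : ℕ => c k * s) atTop (𝓝 (0 * s)) := by
        refine Tendsto.mul_const _ ?_
        have : Tendsto (fun k : ℕ => ((k : ℝ) + 1)⁻¹) atTop (𝓝 0) :=
          tendsto_inv_atTop_zero.comp (tendsto_atTop_add_const_right _ _ tendsto_natCast_atTop_atTop)
        have h2 := this.pow 2
        rw [zero_pow two_ne_zero] at h2
        exact h2
      have h2 := ((Real.continuous_exp.tendsto _).comp (h1.neg)).const_mul (levyDensity s)
      rw [zero_mul, neg_zero, Real.exp_zero, mul_one] at h2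
      exact h2
    exact tendsto_nhds_unique (tendsto_atTop_iSup fun k l hkl => hmono hkl s) ht
  have hlim : ∫⁻ s in Ioi (0 : ℝ), ENNReal.ofReal (levyDensity s) =
      ⨆ k, ∫⁻ s in Ioi (0 : ℝ), ENNReal.ofReal (levyDensity s * Real.exp (-(c k * s))) := by
    rw [← lintegral_iSup (fun k => ?_) hmono]
    · simp_rw [hsup]
    · exact (measurable_levyDensity.mul (by fun_prop)).ennreal_ofReal
  rw [hmass, hlim]
  simp_rw [hF]
  -- `⨆ e^{-√c_k} = 1`
  have ht : Tendsto (fun k => ENNReal.ofReal (Real.exp (-Real.sqrt (c k)))) atTop (𝓝 1) := by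
    rw [← ENNReal.ofReal_one]
    refine ENNReal.tendsto_ofReal ?_
    have h1 : Tendsto (fun k : ℕ => Real.sqrt (c k)) atTop (𝓝 0) := by
      have : Tendsto (fun k : ℕ => ((k : ℝ) + 1)⁻¹) atTop (𝓝 0) :=
        tendsto_inv_atTop_zero.comp (tendsto_atTop_add_const_right _ _ tendsto_natCast_atTop_atTop)
      have e : ∀ k : ℕ, Real.sqrt (c k) = ((k : ℝ) + 1)⁻¹ := fun k => by
        simp only [hc]; exact Real.sqrt_sq (by positivity)
      simp_rw [e]; exact this
    have h2 := (Real.continuous_exp.tendsto _).comp h1.neg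
    rw [neg_zero, Real.exp_zero] at h2
    exact h2
  have hmono' : Monotone fun k => ENNReal.ofReal (Real.exp (-Real.sqrt (c k))) := by
    intro k l hkl
    have := lintegral_mono (μ := volume.restrict (Ioi (0:ℝ))) (hmono hkl)
    simpa only [hF] using this
  exact tendsto_nhds_unique (tendsto_atTop_iSup hmono') ht

/-- `∫ e^{-c s} dℓ(s) = e^{-√c}` for all `c ≥ 0` (at `c = 0` both sides are `1`). [folklore] -/
theorem integral_exp_neg_mul_levyMeasure_of_nonneg {c : ℝ} (hc : 0 ≤ c) :
    ∫ s, Real.exp (-(c * s)) ∂levyMeasure = Real.exp (-Real.sqrt c) := by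
  rcases hc.eq_or_lt with h | h
  · subst h; simp
  · exact integral_exp_neg_mul_levyMeasure h

/-! ## Subordination: Laplace transforms in `|n|` are Gaussian scale mixtures in `n` -/

/-- **Lévy subordination.** If `K n = ∫ e^{-a|n|} dμ(a)` for a finite measure `μ` carried by
`[0,∞)`, then `K n = ∫ e^{-s n²} dρ(s)` for the finite measure `ρ := (μ ⊗ ℓ).map ((a,s) ↦ a² s)`,
which is carried by `[0,∞)` and has the same total mass as `μ` (Bochner's subordination of the
Laplace kernel by the stable-½ law: `e^{-a|n|} = ∫ e^{-a² s n²} dℓ(s)`). [folklore] -/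
theorem exists_gsm_of_laplace (μ : Measure ℝ) [IsFiniteMeasure μ] (hsupp : μ (Ici (0 : ℝ))ᶜ = 0)
    (K : ℤ → ℝ) (hK : ∀ n : ℤ, K n = ∫ a, Real.exp (-(a * |(n : ℝ)|)) ∂μ) :
    ∃ ρ : Measure ℝ, IsFiniteMeasure ρ ∧ ρ (Ici (0 : ℝ))ᶜ = 0 ∧ ρ univ = μ univ ∧
      ∀ n : ℤ, K n = ∫ s, Real.exp (-(s * (n : ℝ) ^ 2)) ∂ρ := by
  set T : ℝ × ℝ → ℝ := fun p => p.1 ^ 2 * p.2 with hT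
  have hTm : Measurable T := by fun_prop
  refine ⟨(μ.prod levyMeasure).map T, inferInstance, ?_, ?_, fun n => ?_⟩
  · -- carried by `[0,∞)`: `a² s < 0` forces `s < 0`, an `ℓ`-null event
    rw [Measure.map_apply hTm (measurableSet_Ici.compl)]
    have hsub : T ⁻¹' (Ici (0 : ℝ))ᶜ ⊆ (univ : Set ℝ) ×ˢ Iic (0 : ℝ) := by
      intro p hp
      simp only [mem_preimage, mem_compl_iff, mem_Ici, not_le, hT] at hp
      refine ⟨mem_univ _, ?_⟩
      by_contra h
      simp only [mem_Iic, not_le] at h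
      exact absurd hp (not_lt.2 (mul_nonneg (sq_nonneg _) h.le))
    refine measure_mono_null hsub ?_
    rw [Measure.prod_prod, levyMeasure_Iic_zero, mul_zero]
  · rw [Measure.map_apply hTm MeasurableSet.univ, preimage_univ, ← univ_prod_univ,
      Measure.prod_prod, show levyMeasure univ = 1 from measure_univ, mul_one]
  · rw [hK n, integral_map hTm.aemeasurable (by fun_prop : Continuous fun s : ℝ =>
        Real.exp (-(s * (n : ℝ) ^ 2))).aestronglyMeasurable]
    -- Fubini
    have hint : Integrable (fun p : ℝ × ℝ => Real.exp (-(T p * (n : ℝ) ^ 2))) (μ.prod levyMeasure) := by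
      refine Integrable.mono' (integrable_const (1 : ℝ)) (by fun_prop : Continuous fun p : ℝ × ℝ =>
        Real.exp (-(T p * (n : ℝ) ^ 2))).aestronglyMeasurable ?_
      -- `ℓ`-a.e. `s > 0`, hence the integrand is `≤ 1`
      have hae : ∀ᵐ p ∂(μ.prod levyMeasure), 0 ≤ p.2 := by
        rw [ae_iff]
        have : {p : ℝ × ℝ | ¬0 ≤ p.2} ⊆ (univ : Set ℝ) ×ˢ Iic (0 : ℝ) := fun p hp =>
          ⟨mem_univ _, (not_le.1 hp).le⟩
        refine measure_mono_null this ?_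
        rw [Measure.prod_prod, levyMeasure_Iic_zero, mul_zero]
      filter_upwards [hae] with p hp
      rw [Real.norm_eq_abs, abs_of_pos (Real.exp_pos _), Real.exp_le_one_iff, neg_nonpos, hT]
      exact mul_nonneg (mul_nonneg (sq_nonneg _) hp) (sq_nonneg _)
    rw [integral_prod _ hint]
    refine integral_congr_ae ?_
    -- `μ`-a.e. `a ≥ 0`, where the inner integral is `e^{-a|n|}`
    have hae : ∀ᵐ a ∂μ, 0 ≤ a := by
      rw [ae_iff]
      have : {a : ℝ | ¬0 ≤ a} ⊆ (Ici (0 : ℝ))ᶜ := fun a ha => ha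
      exact measure_mono_null this hsupp
    filter_upwards [hae] with a ha
    have e : (fun s : ℝ => Real.exp (-(T (a, s) * (n : ℝ) ^ 2))) =
        fun s => Real.exp (-((a ^ 2 * (n : ℝ) ^ 2) * s)) := by
      funext s; simp only [hT]; ring_nf
    rw [e, integral_exp_neg_mul_levyMeasure_of_nonneg (by positivity)]
    congr 1
    rw [show a ^ 2 * (n : ℝ) ^ 2 = (a * |(n : ℝ)|) ^ 2 by rw [mul_pow, sq_abs],
      Real.sqrt_sq (mul_nonneg ha (abs_nonneg _))]

end AxisGSM

/-! ## The axial two-point function is a Gaussian scale mixture -/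

/-- **Axial Gaussian scale mixture, `m*(β) = 0`.** For the nearest-neighbour Ising model on
`ℤ^{d'+1}`, `β > 0` with `m*(β) = 0`, and every axis `i`, there is a finite positive measure `ρ`
on `[0, ∞)` with `⟨σ₀ σ_{n eᵢ}⟩⁺_β = ∫ e^{-s n²} dρ(s)` for all `n ∈ ℤ` (Aizenman–Duminil-Copin 2021
Prop. 8.6, `⟨σ₀σ_{neᵢ}⟩ = ∫ e^{-a|n|}dμ`, composed with Lévy subordination `e^{-a|n|} =
∫ e^{-a²sn²} dℓ(s)`). [cite: AizenmanDuminilCopinAnnals2021, Appendix §8.3 Prop. 8.6 (= Prop. 5.3)] -/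
theorem twoPointPlus_axis_gaussianScaleMixture (d' : ℕ) {β : ℝ} (hβ : 0 < β)
    (hm : spontaneousMagnetization (d' + 1) β = 0) (i : Fin (d' + 1)) :
    ∃ ρ : Measure ℝ, IsFiniteMeasure ρ ∧ ρ (Ici (0 : ℝ))ᶜ = 0 ∧
      ∀ n : ℤ, twoPointPlus (d' + 1) β (Pi.single i n) = ∫ s, Real.exp (-(s * (n : ℝ) ^ 2)) ∂ρ := by
  obtain ⟨μ, hfin, hsupp, hrep⟩ := AizenmanDuminilCopin2021_prop_8_6_holds d' β hβ hm i
  obtain ⟨ρ, hρfin, hρsupp, -, hρ⟩ := AxisGSM.exists_gsm_of_laplace μ hsupp _ hrep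
  exact ⟨ρ, hρfin, hρsupp, hρ⟩

/-- **The critical axial two-point function of the `d ≥ 3` Ising model is a Gaussian scale mixture
with a probability mixing measure**: for `d = d'+1 ≥ 3` and every axis `i` there is a probability
measure `ρ` on `[0,∞)` with `⟨σ₀ σ_{n eᵢ}⟩⁺_{β_c} = ∫ e^{-s n²} dρ(s)` for all `n ∈ ℤ`
(`m*(β_c) = 0` and `β_c > 0` for `d ≥ 3` are the tree's `…_holds` theorems; mass `1` from
`⟨σ₀σ₀⟩ = 1`). The one-axis shadow of the conjectured joint Gaussian-scale-mixture structure of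
`⟨σ₀σ_x⟩⁺_{β_c}` on `ℤ³`. [cite: AizenmanDuminilCopinAnnals2021, Appendix §8.3 Prop. 8.6 (= Prop. 5.3)] -/
theorem criticalTwoPoint_axis_gaussianScaleMixture {d' : ℕ} (hd : 3 ≤ d' + 1) (i : Fin (d' + 1)) :
    ∃ ρ : Measure ℝ, IsProbabilityMeasure ρ ∧ ρ (Ici (0 : ℝ))ᶜ = 0 ∧
      ∀ n : ℤ, criticalTwoPoint (d' + 1) (Pi.single i n) =
        ∫ s, Real.exp (-(s * (n : ℝ) ^ 2)) ∂ρ := by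
  have hβ : 0 < criticalBeta (d' + 1) := criticalBeta_pos_holds (d := d' + 1) (by omega)
  have hm : spontaneousMagnetization (d' + 1) (criticalBeta (d' + 1)) = 0 :=
    spontaneousMagnetization_criticalBeta_eq_zero_holds (d := d' + 1) hd
  obtain ⟨μ, hfin, hsupp, hrep⟩ := AizenmanDuminilCopin2021_prop_8_6_holds d' _ hβ hm i
  obtain ⟨ρ, hρfin, hρsupp, hmass, hρ⟩ := AxisGSM.exists_gsm_of_laplace μ hsupp _ hrep
  refine ⟨ρ, ⟨?_⟩, hρsupp, fun n => hρ n⟩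
  -- mass: `ρ(ℝ) = μ(ℝ) = ⟨σ₀σ₀⟩ = 1`
  have h0 := hrep 0
  simp only [Int.cast_zero, abs_zero, mul_zero, neg_zero, Real.exp_zero, integral_const,
    smul_eq_mul, mul_one, Pi.single_zero, twoPointPlus_zero] at h0
  rw [hmass]
  exact (ENNReal.toReal_eq_one_iff _).1 h0.symm

end Literature.Probability.LatticeModels

end
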